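import Mathlib.Algebra.MvPolynomial.Equiv
import Mathlib.Algebra.MvPolynomial.Monad
import Literature.Computability.QuantumComplexity.CubicForrelation

/-!
# Crux `CubicForrelation.SignedCubicForrelationNotPrBPP` (stmt-QuantumAdvantage-13931) — line `Sketch`

Degree toolkit for the lead's stub `stub_kernelNormalForm` (kernel normal form of a cubic Boolean
function with an affine derivative): closure properties of `IsDegLeFun d` (functions on `{0,1}ⁿ`
represented by a polynomial over `𝔽₂` of total degree `≤ d`, `CubicForrelation.lean`) that the
coordinate changes of the kernel-descent step need.

* `knf_isDegLeFun_comp` — substitution: if `f` has degree `≤ d` and every coordinate of a map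
  `M : {0,1}ᵐ → {0,1}ⁿ` is affine (degree `≤ 1`), then `f ∘ M` has degree `≤ d`
  (`bind₁` by polynomials of degree `≤ 1` does not raise the total degree).
* `knf_isDegLeFun_xor'` — `f ⊕ g` has degree `≤ max d d'`.
* `knf_isDegLeFun_coord_step` — `u ↦ g(0,1,u) ⊕ g(0,0,u)` has degree `≤ d` when `g` has degree
  `≤ d + 1` on `n + 2` bits (a coordinate derivative lowers the degree: `finSuccEquiv` and
  `totalDegree_coeff_finSuccEquiv_add_le`).

All statements are over the tree's `IsDegLeFun` / `polyPhase`; everything is proved (Mathlib only).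
-/

noncomputable section

set_option linter.dupNamespace false -- D-0017: single-problem summit ⇒ QuantumAdvantage.QuantumAdvantage by design

namespace Summit.QuantumAdvantage.QuantumAdvantage.Theorems.SignedCubicForrelationNotPrBPP

open MvPolynomial Literature.Computability.QuantumComplexity

variable {m n d : ℕ}

/-! ### Substitution by affine coordinates -/

/-- A substitution by polynomials of total degree `≤ 1` does not increase the total degree. -/
theorem knf_totalDegree_bind₁_le {R : Type*} [CommSemiring R] {σ τ : Type*}
    {h : σ → MvPolynomial τ R} (hh : ∀ v, (h v).totalDegree ≤ 1) (p : MvPolynomial σ R) :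
    (bind₁ h p).totalDegree ≤ p.totalDegree := by
  classical
  conv_lhs => rw [p.as_sum, map_sum]
  refine (totalDegree_finsetSum _ _).trans (Finset.sup_le fun e he => ?_)
  rw [bind₁_monomial]
  refine (totalDegree_mul _ _).trans ?_
  rw [totalDegree_C, zero_add]
  refine (totalDegree_finsetProd _ _).trans ?_
  refine le_trans (Finset.sum_le_sum fun v _ => (totalDegree_pow _ _).trans
    (Nat.mul_le_mul_left _ (hh v))) ?_
  simp only [mul_one]
  exact le_totalDegree he

/-- Reading `[z = 1]` back in `𝔽₂` gives `z`. -/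
theorem knf_ite_decide_eq (z : ZMod 2) : (if decide (z = 1) then (1 : ZMod 2) else 0) = z := by
  fin_cases z <;> rfl

/-- **Substitution.** If `f : {0,1}ⁿ → {0,1}` has degree `≤ d` and every coordinate of
`M : {0,1}ᵐ → {0,1}ⁿ` has degree `≤ 1`, then `x ↦ f (M x)` has degree `≤ d`. -/
theorem knf_isDegLeFun_comp {f : (Fin n → Bool) → Bool} (hf : IsDegLeFun d f)
    (M : (Fin m → Bool) → (Fin n → Bool)) (hM : ∀ j, IsDegLeFun 1 (fun x => M x j)) :
    IsDegLeFun d (fun x => f (M x)) := by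
  obtain ⟨p, hp, hfp⟩ := hf
  choose q hq hMq using hM
  refine ⟨bind₁ q p, (knf_totalDegree_bind₁_le hq p).trans hp, fun x => ?_⟩
  show f (M x) = _
  rw [hfp (M x), polyPhase_apply, polyPhase_apply]
  have key : eval (fun j => if x j then (1 : ZMod 2) else 0) (bind₁ q p) =
      eval (fun i => eval (fun j => if x j then (1 : ZMod 2) else 0) (q i)) p :=
    aeval_bind₁ _ q p
  have hfun : (fun j => if M x j then (1 : ZMod 2) else 0) =
      (fun i => eval (fun j => if x j then (1 : ZMod 2) else 0) (q i)) := by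
    funext i
    have h2 : M x i = polyPhase (q i) x := hMq i x
    rw [h2, polyPhase_apply, knf_ite_decide_eq]
  rw [key, hfun]

/-! ### Closure under `⊕` -/

/-- `polyPhase (p + q) = polyPhase p ⊕ polyPhase q` (as functions). -/
theorem knf_polyPhase_add' (p q : MvPolynomial (Fin n) (ZMod 2)) :
    polyPhase (p + q) = fun x => (polyPhase p x ^^ polyPhase q x) := by
  have h2 : ∀ a b : ZMod 2, decide (a + b = 1) = (decide (a = 1) ^^ decide (b = 1)) := by decide
  funext x
  rw [polyPhase_apply, polyPhase_apply, polyPhase_apply, eval_add, h2]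

/-- **Xor, mixed degrees.** If `f` has degree `≤ d` and `g` degree `≤ d'` then `f ⊕ g` has degree
`≤ max d d'`. -/
theorem knf_isDegLeFun_xor' {d' : ℕ} {f g : (Fin n → Bool) → Bool} (hf : IsDegLeFun d f)
    (hg : IsDegLeFun d' g) : IsDegLeFun (max d d') (fun x => f x ^^ g x) := by
  obtain ⟨p, hp, hfp⟩ := hf
  obtain ⟨q, hq, hgq⟩ := hg
  refine ⟨p + q, (totalDegree_add p q).trans (max_le_max hp hq), fun x => ?_⟩
  show (f x ^^ g x) = polyPhase (p + q) x
  rw [knf_polyPhase_add', hfp x, hgq x]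

/-- `x ↦ xᵢ ∧ c` has degree `≤ 1` for a constant bit `c`. -/
theorem knf_isDegLeFun_and_const (i : Fin n) (c : Bool) :
    IsDegLeFun 1 (fun x : Fin n → Bool => x i && c) := by
  cases c
  · simpa using isDegLeFun_const (n := n) 1 false
  · simpa using isDegLeFun_apply (n := n) i le_rfl

/-- Xor with a constant keeps the degree. -/
theorem knf_isDegLeFun_xor_const {f : (Fin n → Bool) → Bool} (hf : IsDegLeFun d f) (c : Bool) :
    IsDegLeFun d (fun x => f x ^^ c) := by
  simpa using knf_isDegLeFun_xor' hf (isDegLeFun_const d c)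

/-- `x ↦ xⱼ ⊕ (xᵢ ∧ c)` is affine (for a constant bit `c`). -/
theorem knf_isDegLeFun_coord_xor_and (j i : Fin n) (c : Bool) :
    IsDegLeFun 1 (fun x : Fin n → Bool => x j ^^ (x i && c)) := by
  simpa using knf_isDegLeFun_xor' (isDegLeFun_apply j le_rfl) (knf_isDegLeFun_and_const i c)

/-! ### A coordinate derivative lowers the degree -/

/-- Evaluating at a point with first coordinate `0` reads the constant coefficient of
`finSuccEquiv`. -/
theorem knf_eval_cons_zero (s : Fin n → ZMod 2) (f : MvPolynomial (Fin (n + 1)) (ZMod 2)) :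
    eval (Fin.cons 0 s : Fin (n + 1) → ZMod 2) f = eval s ((finSuccEquiv (ZMod 2) n f).coeff 0) := by
  rw [eval_eq_eval_mv_eval', ← Polynomial.coeff_zero_eq_eval_zero, Polynomial.coeff_map]

/-- The evaluation at first coordinate `1` is the sum of all coefficients of `finSuccEquiv`,
evaluated (written over `range (natDegree + 1)`). -/
theorem knf_eval_cons_one (s : Fin n → ZMod 2) (f : MvPolynomial (Fin (n + 1)) (ZMod 2)) :
    eval (Fin.cons 1 s : Fin (n + 1) → ZMod 2) f =
      ∑ i ∈ Finset.range ((finSuccEquiv (ZMod 2) n f).natDegree + 1),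
        eval s ((finSuccEquiv (ZMod 2) n f).coeff i) := by
  rw [eval_eq_eval_mv_eval',
    Polynomial.eval_eq_sum_range' (Nat.lt_succ_of_le Polynomial.natDegree_map_le)]
  refine Finset.sum_congr rfl fun i _ => ?_
  rw [Polynomial.coeff_map, one_pow, mul_one]

/-- **Coordinate derivative, polynomial level.** For `f` over `n + 1` variables there is a polynomial
`q` over the last `n` variables with `totalDegree q + 1 ≤ totalDegree f` (when `f` has positive
degree; in general `totalDegree q ≤ totalDegree f - 1`) and `f(1,s) + f(0,s) = q(s)`. -/
theorem knf_exists_coord_derivative (f : MvPolynomial (Fin (n + 1)) (ZMod 2)) :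
    ∃ q : MvPolynomial (Fin n) (ZMod 2), q.totalDegree + 1 ≤ max f.totalDegree 1 ∧
      ∀ s : Fin n → ZMod 2, eval (Fin.cons 1 s : Fin (n + 1) → ZMod 2) f +
        eval (Fin.cons 0 s : Fin (n + 1) → ZMod 2) f = eval s q := by
  refine ⟨∑ i ∈ Finset.Ico 1 ((finSuccEquiv (ZMod 2) n f).natDegree + 1),
    (finSuccEquiv (ZMod 2) n f).coeff i, ?_, fun s => ?_⟩
  · -- degree: every positive-index coefficient has degree ≤ totalDegree f - i
    have key : ∀ i ∈ Finset.Ico 1 ((finSuccEquiv (ZMod 2) n f).natDegree + 1),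
        ((finSuccEquiv (ZMod 2) n f).coeff i).totalDegree + 1 ≤ max f.totalDegree 1 := by
      intro i hi
      rw [Finset.mem_Ico] at hi
      by_cases h0 : (finSuccEquiv (ZMod 2) n f).coeff i = 0
      · rw [h0, totalDegree_zero]; exact le_max_right _ _
      · have := totalDegree_coeff_finSuccEquiv_add_le f i h0
        exact le_trans (by omega) (le_max_left _ _)
    have hsum := totalDegree_finsetSum (Finset.Ico 1 ((finSuccEquiv (ZMod 2) n f).natDegree + 1))
      (fun i => (finSuccEquiv (ZMod 2) n f).coeff i)
    rcases (Finset.Ico 1 ((finSuccEquiv (ZMod 2) n f).natDegree + 1)).eq_empty_or_nonempty with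
      hempty | hne
    · rw [hempty, Finset.sum_empty, totalDegree_zero]; exact le_max_right _ _
    · obtain ⟨i, hi, hmax⟩ := Finset.exists_mem_eq_sup _ hne
        (fun i => ((finSuccEquiv (ZMod 2) n f).coeff i).totalDegree)
      rw [hmax] at hsum
      exact le_trans (Nat.add_le_add_right hsum 1) (key i hi)
  · rw [knf_eval_cons_one, knf_eval_cons_zero, map_sum, Finset.range_eq_Ico,
      Finset.sum_eq_sum_Ico_succ_bot (Nat.succ_pos _)]
    rw [add_comm (eval s ((finSuccEquiv (ZMod 2) n f).coeff 0)), add_assoc, CharTwo.add_self_eq_zero, add_zero]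

/-- The `𝔽₂`-point of `Fin.cons c u` is `Fin.cons [c] [u]`. -/
theorem knf_pt_cons {k : ℕ} (c : Bool) (u : Fin k → Bool) :
    (fun j => if (Fin.cons c u : Fin (k + 1) → Bool) j then (1 : ZMod 2) else 0) =
      Fin.cons (if c then (1 : ZMod 2) else 0) (fun j => if u j then (1 : ZMod 2) else 0) := by
  funext j
  refine Fin.cases ?_ (fun i => ?_) j
  · simp
  · simp

/-- **Coordinate derivative lowers the degree.** If `g` on `n + 2` bits has degree `≤ d + 1` then
`u ↦ g(0,1,u) ⊕ g(0,0,u)` (the derivative in the coordinate direction `e₁`, restricted to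
`x₀ = 0`) has degree `≤ d`. -/
theorem knf_isDegLeFun_coord_step {g : (Fin (n + 2) → Bool) → Bool} (hg : IsDegLeFun (d + 1) g) :
    IsDegLeFun d (fun u : Fin n → Bool =>
      g (Fin.cons false (Fin.cons true u)) ^^ g (Fin.cons false (Fin.cons false u))) := by
  obtain ⟨p, hp, hgp⟩ := hg
  -- restrict to x₀ = 0
  set r : MvPolynomial (Fin (n + 1)) (ZMod 2) := (finSuccEquiv (ZMod 2) (n + 1) p).coeff 0 with hr
  have hrdeg : r.totalDegree ≤ d + 1 := by
    by_cases h0 : r = 0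
    · rw [h0, totalDegree_zero]; exact Nat.zero_le _
    · have := totalDegree_coeff_finSuccEquiv_add_le p 0 h0
      rw [add_zero] at this
      exact this.trans hp
  have hr_eval : ∀ (c : Bool) (u : Fin n → Bool),
      eval (fun j => if (Fin.cons false (Fin.cons c u) : Fin (n + 2) → Bool) j then (1 : ZMod 2) else 0) p =
        eval (Fin.cons (if c then (1 : ZMod 2) else 0) (fun j => if u j then (1 : ZMod 2) else 0)) r := by
    intro c u
    rw [knf_pt_cons, knf_pt_cons]
    simp only [Bool.false_eq_true, ↓reduceIte]
    exact knf_eval_cons_zero _ p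
  obtain ⟨q, hqdeg, hq⟩ := knf_exists_coord_derivative r
  refine ⟨q, ?_, fun u => ?_⟩
  · have : max r.totalDegree 1 ≤ d + 1 := max_le hrdeg (by omega)
    omega
  · have h2 : ∀ a b : ZMod 2, decide (a + b = 1) = (decide (a = 1) ^^ decide (b = 1)) := by decide
    show (g _ ^^ g _) = _
    rw [hgp, hgp, polyPhase_apply, polyPhase_apply, hr_eval, hr_eval, ← h2]
    simp only [↓reduceIte, Bool.false_eq_true]
    rw [hq]
    rfl

/-! ### Parities of coordinates are affine -/

/-- **Inner products are affine.** For a fixed `κ ∈ 𝔽₂ⁿ`, the parity `x ↦ ⟪x, κ⟫ = ⊕ᵢ xᵢκᵢ`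
(written as `decide (Odd #{i | xᵢ ∧ κᵢ})`) has degree `≤ 1`: it is the polynomial `Σ_{i : κᵢ} Xᵢ`. -/
theorem knf_isDegLeFun_ip (κ : Fin n → Bool) :
    IsDegLeFun 1 (fun x : Fin n → Bool =>
      decide (Odd (Finset.univ.filter fun i => x i && κ i).card)) := by
  classical
  refine ⟨∑ i ∈ Finset.univ.filter (fun i => κ i), X i, ?_, fun x => ?_⟩
  · exact totalDegree_finsetSum_le fun i _ => (totalDegree_X (R := ZMod 2) i).le
  · rw [polyPhase_apply, map_sum]
    simp only [eval_X]
    rw [Finset.sum_boole, decide_eq_decide, ZMod.natCast_eq_one_iff_odd, Finset.filter_filter]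
    have hf : (Finset.univ.filter fun i => x i && κ i) =
        Finset.univ.filter fun i => κ i = true ∧ x i = true := by
      ext i
      simp only [Finset.mem_filter, Finset.mem_univ, true_and, Bool.and_eq_true]
      exact and_comm
    rw [hf]

/-- Coordinates of a TRANSVECTION `x ↦ x ⊕ xᵢ·κ` are affine. -/
theorem knf_isDegLeFun_transvec_coord (i : Fin n) (κ : Fin n → Bool) (j : Fin n) :
    IsDegLeFun 1 (fun x : Fin n → Bool => x j ^^ (x i && κ j)) :=
  knf_isDegLeFun_coord_xor_and j i (κ j)

/-- Coordinates of a TRANSPOSED TRANSVECTION `u ↦ u ⊕ ⟪u,κ⟫·eᵢ` are affine. -/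
theorem knf_isDegLeFun_dualtransvec_coord (i : Fin n) (κ : Fin n → Bool) (j : Fin n) :
    IsDegLeFun 1 (fun u : Fin n → Bool =>
      u j ^^ (decide (j = i) && decide (Odd (Finset.univ.filter fun l => u l && κ l).card))) := by
  by_cases h : j = i
  · simp only [h, decide_true, Bool.true_and]
    simpa using knf_isDegLeFun_xor' (isDegLeFun_apply i le_rfl) (knf_isDegLeFun_ip κ)
  · simp only [h, decide_false, Bool.false_and, Bool.xor_false]
    exact isDegLeFun_apply j le_rfl

/-- Coordinates of a COORDINATE PERMUTATION `x ↦ x ∘ σ` are affine. -/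
theorem knf_isDegLeFun_perm_coord (σ : Equiv.Perm (Fin n)) (j : Fin n) :
    IsDegLeFun 1 (fun x : Fin n → Bool => x (σ j)) :=
  isDegLeFun_apply (σ j) le_rfl

/-- Coordinates of the embedding `u ↦ (c₀, c₁, u)` of `𝔽₂ⁿ` into `𝔽₂ⁿ⁺²` are affine. -/
theorem knf_isDegLeFun_cons_cons_coord (c₀ c₁ : Bool) (j : Fin (n + 2)) :
    IsDegLeFun 1 (fun u : Fin n → Bool => (Fin.cons c₀ (Fin.cons c₁ u) : Fin (n + 2) → Bool) j) := by
  refine Fin.cases ?_ (fun j' => ?_) j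
  · simpa using isDegLeFun_const (n := n) 1 c₀
  · refine Fin.cases ?_ (fun j'' => ?_) j'
    · simpa using isDegLeFun_const (n := n) 1 c₁
    · simpa using isDegLeFun_apply (n := n) j'' le_rfl

/-- Coordinates of the embedding `u ↦ (c, u)` of `𝔽₂ⁿ` into `𝔽₂ⁿ⁺¹` are affine. -/
theorem knf_isDegLeFun_cons_coord (c : Bool) (j : Fin (n + 1)) :
    IsDegLeFun 1 (fun u : Fin n → Bool => (Fin.cons c u : Fin (n + 1) → Bool) j) := by
  refine Fin.cases ?_ (fun j' => ?_) j
  · simpa using isDegLeFun_const (n := n) 1 c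
  · simpa using isDegLeFun_apply (n := n) j' le_rfl

/-! ### Registered form -/

/-- **Registered sub-goal `knf_coord_derivative_degree` (helper of `stub_kernelNormalForm`).**
A coordinate derivative of a function of degree `≤ d + 1` on `n + 2` bits has degree `≤ d`. -/
theorem knf_coord_derivative_degree :
    ∀ (n d : ℕ) (g : (Fin (n + 2) → Bool) → Bool), IsDegLeFun (d + 1) g →
      IsDegLeFun d (fun u : Fin n → Bool =>
        g (Fin.cons false (Fin.cons true u)) ^^ g (Fin.cons false (Fin.cons false u))) :=
  fun _ _ _ hg => knf_isDegLeFun_coord_step hg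

end Summit.QuantumAdvantage.QuantumAdvantage.Theorems.SignedCubicForrelationNotPrBPP

end
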